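import Summits.Ventures.CertifiedManyBodySolver.Rows.HalfFilledTL
import Literature.MathematicalPhysics.QuantumLattice.GroundStateSpinReflectionPositivityHubbard
import Literature.MathematicalPhysics.QuantumLattice.HubbardTorusLimitSpinCorrelationSign
import Literature.MathematicalPhysics.QuantumLattice.HubbardCorrelatorCertificate
import HarnessLib

/-!
# Ventures/CertifiedManyBodySolver — Rows part 29: `HalfFilledTLLiebGram` (Lieb's spin-reflection-positivity
Gram block in the THERMODYNAMIC LIMIT — the `liebgram` / T-16 block kind for `setting: TL`)

HONEST FRAMING: first certified bounds; not a superconductivity verdict; every number certified or labelled float.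

For every torus-limit half-filled ground state `ω` of the square-lattice Hubbard model (the class TLGS(U) of
Rows part 1, `M2.IsTLGS`: weak-* limits of translation averages of `L²`-particle ground states of the even
`L × L` tori, `t = 1`, `U > 0`; more generally every `InfVolFermionState.IsTorusLimitOf` limit along even
tori, `t ≠ 0`), every finite region `Λ ⊂ ℤ²`, every finite family of hopping words
`w : κ → List (Λ × Λ)` and every positive semidefinite `G : Matrix κ κ ℂ`:

  `0 ≤ Re ω_Λ( Σ_{a,b} G_ab · u(w a) · d̃(w b) )`        (`IsTLGS.re_expect_liebForm_nonneg`)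
  `0 ≤ Re ω_Λ( Σ_{a,b} G_ab · d(w a) · ũ(w b) )`        (`IsTLGS.re_expect_liebFormFlip_nonneg`)

with `u(l) = Π c†_{i↑}c_{j↑}`, `d̃(l) = Π ε_iε_j c_{i↓}c†_{j↓}` (Shiba transform), `ε_x = (-1)^{x₁+x₂}` the
staggered sign of `ℤ²` (`siteSign`; on the region, `regionSign Λ`).  These are EXACTLY the Literature
objects `LiebTwo.liebForm` / `LiebTwo.liebFormFlip` over the local algebra `𝔄(Λ)`, so a TL certificate's
`liebgram` block `M_ab = ω(u_a Θ(u_b))` is admitted by citing these two theorems (finite-volume version: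
`hubbardTorus_liebForm_expect_nonneg(_flip)`, i.e. `hubbardTorus_liebGram_posSemidef`, Lieb 1989).

Proof = the transfer pattern of `HubbardTorusLimitSpinCorrelationSign` (§2 there): pull the region into
every large even torus (`PolySite.toTorusEmb`, injective once `L > diam Λ`), push the Lieb form through the
local-algebra embedding `Γ(ι)` (`fermionEmbed_liebForm`: an algebra homomorphism maps words to words, and
the `ℤ²` staggered sign IS the torus sign `torusSign` at the image for EVEN `L` — `torusSign_ofTorusSite_proj`,
the one parity computation of this file), apply the finite-volume theorem to every translate of the ground
state (again a ground state, `isGroundState_fockTranslate_mulVec`), average, pass to the limit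
(`IsTorusLimitOf.re_expect_nonneg_of_eventually`).  The diagonal `1 × 1` minors are the Shen–Qiu–Tian
sign rules already in the tree (`IsTorusLimitOf.re_expect_spinDotAt_nonpos_of_adj` etc.); the `2 × 2`
identity minor is Rows part 21 (`HalfFilledTLGramMinor`); this file is the full block.
No row is filed here (TL certificate rows are claim nodes); theorems only, no `sorry`.
[cite: LiebPRL1989, proof of Theorem 2] [cite: KullEtAl2024, §5.3] [cite: BratteliRobinsonI1987, §4.3.1]
[cite: ArakiMoriya2003, §4.1 Def. 4.1 (2) and Def. 4.3]
-/

noncomputable section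

namespace Summit.Ventures.CertifiedManyBodySolver

open Literature.MathematicalPhysics.QuantumLattice
open Literature.MathematicalPhysics.QuantumLattice.LiebTwo
open Matrix HubbardWave0 Literature.Probability.LatticeModels Filter Topology
open scoped ComplexOrder BigOperators

namespace M2

/-! ## §1 Words through a local-algebra embedding -/

section Embed

variable {Λ Λ' : Type*} [LinearOrder Λ] [Fintype Λ] [LinearOrder Λ'] [Fintype Λ']

/-- `Γ(φ) u(l) = u(φ l)`: the embedding maps up words to up words. [cite: ArakiMoriya2003, §4.1 Def. 4.1 (2) and Def. 4.3] -/
theorem fermionEmbed_upWord (φ : Λ ↪ Λ') (l : List (Λ × Λ)) :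
    fermionEmbed φ (upWord l) = upWord (l.map (Prod.map φ φ)) := by
  unfold upWord
  rw [map_list_prod, List.map_map, List.map_map]
  congr 1
  apply List.map_congr_left
  intro p _
  simp [Function.comp, map_mul]

/-- `Γ(φ) d(l) = d(φ l)`. [cite: ArakiMoriya2003, §4.1 Def. 4.1 (2) and Def. 4.3] -/
theorem fermionEmbed_downWord (φ : Λ ↪ Λ') (l : List (Λ × Λ)) :
    fermionEmbed φ (downWord l) = downWord (l.map (Prod.map φ φ)) := by
  unfold downWord
  rw [map_list_prod, List.map_map, List.map_map]
  congr 1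
  apply List.map_congr_left
  intro p _
  simp [Function.comp, map_mul]

/-- `Γ(φ) d̃_ε(l) = d̃_{ε'}(φ l)` when the signs agree along `φ` (`ε = ε' ∘ φ`). [cite: LiebPRL1989, proof of Theorem 2] -/
theorem fermionEmbed_shibaDownWord (φ : Λ ↪ Λ') {ε : Λ → ℂ} {ε' : Λ' → ℂ} (hε : ∀ x, ε x = ε' (φ x))
    (l : List (Λ × Λ)) :
    fermionEmbed φ (shibaDownWord ε l) = shibaDownWord ε' (l.map (Prod.map φ φ)) := by
  unfold shibaDownWord
  rw [map_list_prod, List.map_map, List.map_map]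
  congr 1
  apply List.map_congr_left
  intro p _
  simp [Function.comp, map_mul, hε]

/-- `Γ(φ) ũ_ε(l) = ũ_{ε'}(φ l)` when `ε = ε' ∘ φ`. [cite: LiebPRL1989, proof of Theorem 2] -/
theorem fermionEmbed_shibaUpWord (φ : Λ ↪ Λ') {ε : Λ → ℂ} {ε' : Λ' → ℂ} (hε : ∀ x, ε x = ε' (φ x))
    (l : List (Λ × Λ)) :
    fermionEmbed φ (shibaUpWord ε l) = shibaUpWord ε' (l.map (Prod.map φ φ)) := by
  unfold shibaUpWord
  rw [map_list_prod, List.map_map, List.map_map]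
  congr 1
  apply List.map_congr_left
  intro p _
  simp [Function.comp, map_mul, hε]

/-- **`Γ(φ)` maps the Lieb form to the Lieb form of the image words** (same Gram matrix `G`), for
compatible signs. [cite: LiebPRL1989, proof of Theorem 2] [cite: KullEtAl2024, §5.3] -/
theorem fermionEmbed_liebForm (φ : Λ ↪ Λ') {ε : Λ → ℂ} {ε' : Λ' → ℂ} (hε : ∀ x, ε x = ε' (φ x))
    {κ : Type*} [Fintype κ] (G : Matrix κ κ ℂ) (w : κ → List (Λ × Λ)) :
    fermionEmbed φ (liebForm ε G w) = liebForm ε' G (fun a => (w a).map (Prod.map φ φ)) := by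
  simp only [liebForm, map_sum, map_smul, map_mul, fermionEmbed_upWord, fermionEmbed_shibaDownWord φ hε]

/-- The flipped form likewise. [cite: LiebPRL1989, proof of Theorem 2] [cite: KullEtAl2024, §5.3] -/
theorem fermionEmbed_liebFormFlip (φ : Λ ↪ Λ') {ε : Λ → ℂ} {ε' : Λ' → ℂ} (hε : ∀ x, ε x = ε' (φ x))
    {κ : Type*} [Fintype κ] (G : Matrix κ κ ℂ) (w : κ → List (Λ × Λ)) :
    fermionEmbed φ (liebFormFlip ε G w) = liebFormFlip ε' G (fun a => (w a).map (Prod.map φ φ)) := by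
  simp only [liebFormFlip, map_sum, map_smul, map_mul, fermionEmbed_downWord, fermionEmbed_shibaUpWord φ hε]

end Embed

/-! ## §2 The staggered sign of `ℤ²` is the torus sign at the image (even `L`) -/

/-- The staggered (Néel) sign of `ℤ²`: `ε_x = (-1)^{x₁+x₂}`. [cite: LiebPRL1989, Theorem 2] -/
def siteSign (x : Site 2) : ℂ := if Even (x 0 + x 1) then 1 else -1

/-- The staggered sign read on the ordered sites of a region. [cite: LiebPRL1989, Theorem 2] -/
def regionSign (Λ : Finset (Site 2)) (y : PolySite Λ) : ℂ := siteSign (ofLex y.1)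

/-- **For EVEN `L` the torus sign `(-1)^{(x₁ mod L) + (x₂ mod L)}` of the image of `x ∈ ℤ²` is `(-1)^{x₁+x₂}`**
(reduction modulo an even `L` preserves parity). [cite: LiebPRL1989, Theorem 2] -/
theorem torusSign_ofTorusSite_proj {L : ℕ} [NeZero L] (hL : Even L) (x : Site 2) :
    torusSign (FermionTorus.ofTorusSite (Torus.proj L x)) = siteSign x := by
  have h2L : (2 : ℤ) ∣ (L : ℤ) := by obtain ⟨k, hk⟩ := hL; exact ⟨k, by omega⟩
  have hv : ∀ i : Fin 2,
      (((ofLex (FermionTorus.ofTorusSite (Torus.proj L x)) i : ℕ) : ℤ)) % 2 = x i % 2 := by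
    intro i
    rw [FermionTorus.ofLex_ofTorusSite_apply, Torus.proj_apply, ZMod.val_intCast]
    exact Int.emod_emod_of_dvd _ h2L
  set n : ℕ := (ofLex (FermionTorus.ofTorusSite (Torus.proj L x)) 0 : ℕ) +
    (ofLex (FermionTorus.ofTorusSite (Torus.proj L x)) 1 : ℕ) with hn
  have hstag : torusStagger (FermionTorus.ofTorusSite (Torus.proj L x)) = (-1) ^ n := by
    rw [torusStagger_apply, Fin.sum_univ_two]
  have hpar : Even n ↔ Even (x 0 + x 1) := by
    rw [← Int.even_coe_nat, Int.even_iff, Int.even_iff, hn, Nat.cast_add, Int.add_emod, hv 0, hv 1,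
      ← Int.add_emod]
  unfold torusSign siteSign
  rw [hstag]
  by_cases h : Even (x 0 + x 1)
  · rw [if_pos h, show ((-1 : ℤˣ) ^ n) = 1 from (hpar.2 h).neg_one_pow, Units.val_one, Int.cast_one]
  · rw [if_neg h, show ((-1 : ℤˣ) ^ n) = -1 from
      (Nat.not_even_iff_odd.1 fun hn' => h (hpar.1 hn')).neg_one_pow, Units.val_neg, Units.val_one,
      Int.cast_neg, Int.cast_one]

/-- The sign compatibility along the pull-back of a region into an even torus:
`regionSign Λ y = torusSign (ι_{Λ,L} y)`. [cite: LiebPRL1989, Theorem 2] -/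
theorem regionSign_eq_torusSign_toTorusEmb {L : ℕ} [NeZero L] (hL : Even L) {Λ : Finset (Site 2)}
    (hInj : Set.InjOn (Torus.proj (d := 2) L) ↑Λ) (y : PolySite Λ) :
    regionSign Λ y = torusSign (PolySite.toTorusEmb L hInj y) := by
  rw [PolySite.toTorusEmb_apply, torusSign_ofTorusSite_proj hL]
  rfl

/-! ## §3 Lieb's Gram block in the thermodynamic limit -/

/-- **Lieb's spin-reflection-positivity Gram form is nonnegative in every torus-limit half-filled ground
state.** Let `ω` be a torus limit (`IsTorusLimitOf`) of `L²`-particle ground states of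
`hamiltonian (fermionTorusGraph 2 L) t U` along even `L → ∞`, `t ≠ 0`, `U > 0`.  Then for every region `Λ`,
every finite word family `w` and every `G ⪰ 0`: `0 ≤ Re ω_Λ(liebForm ε G w)`, `ε` the staggered sign.
[cite: LiebPRL1989, proof of Theorem 2] [cite: KullEtAl2024, §5.3] [cite: BratteliRobinsonI1987, §4.3.1] -/
theorem IsTorusLimitOf.re_expect_liebForm_nonneg {t U : ℝ} (ht : t ≠ 0) (hU : 0 < U)
    {Ls : ℕ → ℕ} (hLs : Tendsto Ls atTop atTop) (hev : ∀ j, Even (Ls j))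
    {ψ : ∀ L, Fock (Orb (FermionTorus 2 L))}
    (hψ : ∀ j, IsGroundState (hamiltonian (fermionTorusGraph 2 (Ls j)) t U) (Ls j ^ 2) (ψ (Ls j)))
    {ω : InfVolFermionState 2} (hω : ω.IsTorusLimitOf ψ Ls)
    (Λ : Finset (Site 2)) {κ : Type*} [Fintype κ] {G : Matrix κ κ ℂ} (hG : G.PosSemidef)
    (w : κ → List (PolySite Λ × PolySite Λ)) :
    0 ≤ (ω.expect Λ (liebForm (regionSign Λ) G w)).re := by
  refine hω.re_expect_nonneg_of_eventually _ ?_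
  obtain ⟨L₀, hL₀⟩ := exists_forall_le_injOn_proj Λ
  filter_upwards [hLs.eventually (eventually_ge_atTop (max L₀ 1))] with j hj
  have hL1 : 1 ≤ Ls j := le_trans (le_max_right _ _) hj
  haveI : NeZero (Ls j) := ⟨by omega⟩
  have hInj : Set.InjOn (Torus.proj (d := 2) (Ls j)) ↑Λ := hL₀ _ (le_trans (le_max_left _ _) hj)
  rw [torusAvgExpect_eq]
  refine re_torusAvgExpectAt_nonneg_of_forall hInj _ _ fun v => ?_
  have hGS := isGroundState_fockTranslate_mulVec t U v (hψ j)
  rw [fermionEmbed_liebForm (PolySite.toTorusEmb (Ls j) hInj)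
    (fun y => regionSign_eq_torusSign_toTorusEmb (hev j) hInj y) G w]
  have h := hubbardTorus_liebForm_expect_nonneg (hev j) ht hU hGS.1 hGS.2.2 hG
    (fun a => (w a).map (Prod.map (PolySite.toTorusEmb (Ls j) hInj) (PolySite.toTorusEmb (Ls j) hInj)))
  exact (Complex.nonneg_iff.1 h).1

/-- **The flipped Gram form likewise**: `0 ≤ Re ω_Λ(liebFormFlip ε G w)` for every torus-limit half-filled
ground state. [cite: LiebPRL1989, proof of Theorem 2] [cite: KullEtAl2024, §5.3] [cite: BratteliRobinsonI1987, §4.3.1] -/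
theorem IsTorusLimitOf.re_expect_liebFormFlip_nonneg {t U : ℝ} (ht : t ≠ 0) (hU : 0 < U)
    {Ls : ℕ → ℕ} (hLs : Tendsto Ls atTop atTop) (hev : ∀ j, Even (Ls j))
    {ψ : ∀ L, Fock (Orb (FermionTorus 2 L))}
    (hψ : ∀ j, IsGroundState (hamiltonian (fermionTorusGraph 2 (Ls j)) t U) (Ls j ^ 2) (ψ (Ls j)))
    {ω : InfVolFermionState 2} (hω : ω.IsTorusLimitOf ψ Ls)
    (Λ : Finset (Site 2)) {κ : Type*} [Fintype κ] {G : Matrix κ κ ℂ} (hG : G.PosSemidef)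
    (w : κ → List (PolySite Λ × PolySite Λ)) :
    0 ≤ (ω.expect Λ (liebFormFlip (regionSign Λ) G w)).re := by
  refine hω.re_expect_nonneg_of_eventually _ ?_
  obtain ⟨L₀, hL₀⟩ := exists_forall_le_injOn_proj Λ
  filter_upwards [hLs.eventually (eventually_ge_atTop (max L₀ 1))] with j hj
  have hL1 : 1 ≤ Ls j := le_trans (le_max_right _ _) hj
  haveI : NeZero (Ls j) := ⟨by omega⟩
  have hInj : Set.InjOn (Torus.proj (d := 2) (Ls j)) ↑Λ := hL₀ _ (le_trans (le_max_left _ _) hj)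
  rw [torusAvgExpect_eq]
  refine re_torusAvgExpectAt_nonneg_of_forall hInj _ _ fun v => ?_
  have hGS := isGroundState_fockTranslate_mulVec t U v (hψ j)
  rw [fermionEmbed_liebFormFlip (PolySite.toTorusEmb (Ls j) hInj)
    (fun y => regionSign_eq_torusSign_toTorusEmb (hev j) hInj y) G w]
  have h := hubbardTorus_liebFormFlip_expect_nonneg (hev j) ht hU hGS.1 hGS.2.2 hG
    (fun a => (w a).map (Prod.map (PolySite.toTorusEmb (Ls j) hInj) (PolySite.toTorusEmb (Ls j) hInj)))
  exact (Complex.nonneg_iff.1 h).1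

/-- **TLGS(U) form (the M2 class of record, `t = 1`, `U > 0`)**: for every `ω ∈ TLGS(U)`, every region `Λ`,
every word family `w` and every `G ⪰ 0`, `0 ≤ Re ω_Λ(liebForm ε G w)` — the `liebgram` block of a
`setting: TL` certificate is a valid ground-state block. [cite: LiebPRL1989, proof of Theorem 2] [cite: KullEtAl2024, §5.3] -/
theorem IsTLGS.re_expect_liebForm_nonneg {U : ℝ} (hU : 0 < U) {ω : InfVolFermionState 2} (h : IsTLGS U ω)
    (Λ : Finset (Site 2)) {κ : Type*} [Fintype κ] {G : Matrix κ κ ℂ} (hG : G.PosSemidef)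
    (w : κ → List (PolySite Λ × PolySite Λ)) :
    0 ≤ (ω.expect Λ (liebForm (regionSign Λ) G w)).re := by
  obtain ⟨Ls, ψ, hLs, hev, hψ, -, hω⟩ := h
  exact IsTorusLimitOf.re_expect_liebForm_nonneg one_ne_zero hU hLs hev hψ hω Λ hG w

/-- **TLGS(U) form, flipped block** (`liebgram_flip`). [cite: LiebPRL1989, proof of Theorem 2] [cite: KullEtAl2024, §5.3] -/
theorem IsTLGS.re_expect_liebFormFlip_nonneg {U : ℝ} (hU : 0 < U) {ω : InfVolFermionState 2} (h : IsTLGS U ω)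
    (Λ : Finset (Site 2)) {κ : Type*} [Fintype κ] {G : Matrix κ κ ℂ} (hG : G.PosSemidef)
    (w : κ → List (PolySite Λ × PolySite Λ)) :
    0 ≤ (ω.expect Λ (liebFormFlip (regionSign Λ) G w)).re := by
  obtain ⟨Ls, ψ, hLs, hev, hψ, -, hω⟩ := h
  exact IsTorusLimitOf.re_expect_liebFormFlip_nonneg one_ne_zero hU hLs hev hψ hω Λ hG w

/-- **Single-word (rank-one `G`) form**, the shape a certificate line uses: for `c : κ → ℂ`,
`0 ≤ Re ω_Λ( (Σ_a c̄_a u(w a)) · (Σ_b c_b d̃(w b)) )` written as the Lieb form of `G = c̄ cᵀ ⪰ 0`.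
[cite: LiebPRL1989, proof of Theorem 2] -/
theorem IsTLGS.re_expect_liebForm_vecMulVec_nonneg {U : ℝ} (hU : 0 < U) {ω : InfVolFermionState 2}
    (h : IsTLGS U ω) (Λ : Finset (Site 2)) {κ : Type*} [Fintype κ] (c : κ → ℂ)
    (w : κ → List (PolySite Λ × PolySite Λ)) :
    0 ≤ (ω.expect Λ (liebForm (regionSign Λ) (vecMulVec (star c) c) w)).re :=
  h.re_expect_liebForm_nonneg hU Λ (Matrix.posSemidef_vecMulVec_star_self c) w

end M2

end Summit.Ventures.CertifiedManyBodySolver
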